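import Mathlib
import HarnessLib
import Summits.HubbardSuperconductivity.HubbardSuperconductivity.Theorems.KLProgrammeKLRegimeEngineTowerWtAssemblyKlEngRowsSharp4
import Summits.HubbardSuperconductivity.HubbardSuperconductivity.Theorems.KLProgrammeKLRegimeEngineTowerBlockZeroPartitionFn
import Summits.HubbardSuperconductivity.HubbardSuperconductivity.Theorems.KLProgrammeKLRegimeEngineScaleOnePartitionFnUnif
import Summits.HubbardSuperconductivity.HubbardSuperconductivity.Theorems.KLProgrammeKLRegimeEngineScaleZeroKernelNormsWt4Q7
import Summits.HubbardSuperconductivity.HubbardSuperconductivity.Theorems.KLProgrammeKLRegimeEngineV8RaiseDoors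
import Summits.HubbardSuperconductivity.HubbardSuperconductivity.Theorems.KLProgrammeKLRegimeEngineTowerImportBindersWt
import Summits.HubbardSuperconductivity.HubbardSuperconductivity.Theorems.KLProgrammeKLRegimeEngineTowerImportWtArrays
import Summits.HubbardSuperconductivity.HubbardSuperconductivity.Theorems.KLProgrammeKLRegimeEngineSixLegInputFamilyCells
import Summits.HubbardSuperconductivity.HubbardSuperconductivity.Theorems.KLProgrammeKLRegimeEngineSixLegImportByJumpWt

/-!
# ♯4 RE-THREAD, FILE D: «(b)-WT4-ASSEMBLY-∀j» MODULO STRUCTURAL E1 INPUTS, NUMERICS, CAPS AND THE BLOCK-0 LEVELS — «D-ORDER» CURED AND THE SIX-LEG SIDE IN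
# SECTORISED CURRENCY (♯4 item (ii) «(b)-WT4-6LEG-CURRENCY», located by k3c2-p3 g17 KL STATUS l.12210, T2-2 l.12218, pen (R416): the PLAIN six-leg line of the
# effective vertex grows like `U²·4^j/klE0` — the one-line 1PR tree —, so the plain six-leg rows of structural♯3 ll.156–159 / 187–197 were correct as implications
# but UNSATISFIABLE at deep levels; they are REPLACED here)
# Route `KLProgramme` — crux K3 ENGINE (stmt-HubbardSuperconductivity-20437 `KLRegimeEngineV17F2`), stub (b) v2, THE WEIGHTED HALF «(b)-WT4»
# (cell gate-hubbard-kl, seat hubbard-kl-k3c3-p2 g18; = structural♯3 `kernelNormsWt4_all_klEng_structural_sharp3` (p710626) re-keyed on file C; E1 may rename or supersede)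

WHAT CHANGES vs structural♯3 (everything else token-identical — partition functions, level 0, two- and four-leg imports, four-leg cells, thin-count doors):
* «D-ORDER»: head `(R c″) : ∃ C₁ C₂ Cκ CJ C₁r C₂r Cκr CJr C₁i C₂i > 0, ∃ CW₄ > 0, ∀ d, ∃ Cb Cbr > 0, ∃ Cinc₁ Dinc₁ ≥ 1, ∃ Cκ₀ CJ₀ Cα > 0, ∃ Cκz Cbz CJz > 0,
  ∃ CWi > 0, (R.WF2 → …)` with `∃ CW₄ C₆c > 0` before `∀ d` — every d-free constant (in particular `C₂ CJ CJr` of the blocking row `2^{d−1} ≥ 8e⁴·Z·C₂²`) BEFORE `∀ d`;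
* THE SIX-LEG SIDE (faces of record (R425)(3) «(C1′)-CELLS-AT-THE-INPUT-FAMILY» + (R423)(C) «(D1)» free amplitude; located «(R1)-COARSENING-READER-UNSOUND»,
  k3c2-p3 g17 11:13Z: an own-family cell is blind to the annulus `Λ_j ≤ t < Λ_{j−1}` the tower's input family sees): ONE E1 family, the SECTORISED six-leg cell of
  `𝒱_j[K_n]` AT THE INPUT FAMILY `F_{j−1}`, `∀ q w, klWtPinnedSumOf … (K_n) (j−1) 6 (klEffectiveAction … (K_n) klE0 j) q w ≤ S₆·ε_j²·2^{4j}` (`d ≤ j ≤ n`, `S₆ ≥ 0` FREE,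
  fixed before the numerics — never the consumer's `Qe.CE³`, p3 g23's α1-loop test), from which this file DERIVES (i) the six-leg IMPORT row of every block `k ≥ 2` at
  `j = dk` by k3c2-p3's `importRowSix_of_inputFamilyCell` (✓ p715234 §1: `W·Z³·μ₃(k) ≤ 512·W·Z³·S₆·(M/β)⁵·ε_{dk}²`) under the domination `512·W·Z³·S₆·(M/β)⁵ ≤ ι₃`
  (block 1 was read off the base law in file C under `W·Z³·(Ab·Qb³) ≤ ι₃`), and (ii) the OWN-family `m = 6` clause of the level by ONE refinement level `F_{j−1} → F_j`
  (`klWtPinnedSum_six_le_of_inputFamilyCell_klEng_flow_all`, §2: amplitude `C₆c·16·S₆`, `C₆c` hoisted d-free) under the threshold `C₆c·16·S₆ ≤ Qe.CE³` [numerics,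
  a LOWER bound on `Qe.CE`]; the plain six-leg lines `s₆ S₆(j)`, `x₆`, `CW₆`, `ι₃ = x₆·(M/β)⁵` and the six-leg count/threshold rows of structural♯3 are DELETED; the
  six-leg slot of k3c2-p3's three-line glue `importBindersWt_of_wplainLines_flow_all` is fed the trivial finite bound of its plain sums and its output discarded.
* **`kernelNormsWt4_all_klEng_structural_sharp4 (R c″)`** ⊢ `∀ j ≤ n, KernelNormsWt4 L M (klWtBudget P Qe U j) β U μ (klFlowFrameU L M β U μ n) j`.
INPUT CLASSES after this file (exhaustive): [p3 «WB4»] the block-0 levels `1 ≤ j < d`; [p3/p4, kit currency] the level-0 weighted datum rows and the two block-0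
kit guards (discharged in files E/F as before); [E1 structural] weighted plain lines of the two- and four-leg imports (`S₂ s₄`) and of the four-leg cells (`S₄`), the
input-family sectorised six-leg cells (`S₆` free), blocking `d ≥ 2`, `B ≥ 1`; [numerics, p4] doors, the 8 kit rows at every `λ_j`, dominants `κb αb crb ccb`,
`A′ Q″`, the two `ι₃` dominations, `Atot Qtot`, the `CE` row, the thresholds `C₆c·16·S₆ ≤ Qe.CE³` and four-leg, `Atot₁ ≤ Ab` (`d ≤ n`), `Qtot₁ = Qb`; [D] caps; `Qe` a raise of `klEngQ7 P R`.
Bookkeeping composition of landed theorems; nothing asserts (b), WT4's rows, (ℓ), any stub, K3 or superconductivity.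
References: BGM 2006 §2.3 (2.13)–(2.14), §2.7 (2.71a), (2.77), §2.8 (2.76)–(2.84), (2.93)–(2.98), Lemma 2.5, §3 (3.2)–(3.8) [cite: BenfattoGiulianiMastropietro2006].
-/

noncomputable section

namespace Summit.HubbardSuperconductivity.HubbardSuperconductivity.Theorems.EngineV8

set_option linter.dupNamespace false -- summit = problem name (single-conjunct summit), D-0017

open Classical
open Real Finset Literature.MathematicalPhysics.QuantumLattice Literature.Probability.LatticeModels GrassmannAlgebra
open Literature.MathematicalPhysics.QuantumLattice.FermiRG Literature.MathematicalPhysics.QuantumLattice.FermiRG.BGM2006Routing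
open Summit.HubbardSuperconductivity.HubbardSuperconductivity.Theorems.KLProgrammeLegKernels
open Summit.HubbardSuperconductivity.HubbardSuperconductivity.Theorems.KLRegimeSplit
open Summit.HubbardSuperconductivity.HubbardSuperconductivity.Theorems.KLRegimeWick
open Summit.HubbardSuperconductivity.HubbardSuperconductivity.Theorems.TwoPointAssembly
open Summit.HubbardSuperconductivity.HubbardSuperconductivity.Theorems.DispersionFlow
open Summit.HubbardSuperconductivity.HubbardSuperconductivity.Theorems.TorusFourierL2

variable {L M : ℕ} [NeZero L] [NeZero M]

/-! ## The weighted clause at every level, modulo structural E1 inputs, numerics, caps and the block-0 levels — ♯4 -/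

set_option maxHeartbeats 400000 in -- one ~230-binder composition instantiated per level (default × 2)
/-- **STUB (b)'s WEIGHTED CLAUSE ON THE FLOW FRAME — ASSEMBLY MODULO STRUCTURAL E1 INPUTS, NUMERICS, CAPS AND THE BLOCK-0 LEVELS, ♯4** («D-ORDER» cured;
the six-leg side = ONE input-family sectorised cell under a free amplitude, feeding the imports (k3c2-p3 §1) and the level's `m = 6` clause (§2); see the module
docstring for the exhaustive input list);
conclusion `∀ j ≤ n, KernelNormsWt4 L M (klWtBudget P Qe U j) β U μ (klFlowFrameU L M β U μ n) j`.
[cite: BenfattoGiulianiMastropietro2006, §2.3 (2.13)-(2.14), §2.7 (2.71a), (2.77), §2.8 (2.76)-(2.84), (2.93)-(2.98), Lemma 2.5 (2.98), §3 (3.2)-(3.8)] -/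
theorem kernelNormsWt4_all_klEng_structural_sharp4 (R : RenConsts) (c'' : ℝ) (hc'' : 0 < c'') :
    ∃ C₁ C₂ Cκ CJ C₁r C₂r Cκr CJr C₁i C₂i : ℝ, 0 < C₁ ∧ 0 < C₂ ∧ 0 < Cκ ∧ 0 < CJ ∧
      0 < C₁r ∧ 0 < C₂r ∧ 0 < Cκr ∧ 0 < CJr ∧ 0 < C₁i ∧ 0 < C₂i ∧ ∃ CW₄ C₆c : ℝ, 0 < CW₄ ∧ 0 < C₆c ∧
      ∀ d : ℕ, ∃ Cb Cbr : ℝ, 0 < Cb ∧ 0 < Cbr ∧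
      ∃ Cinc₁ Dinc₁ : ℝ, 1 ≤ Cinc₁ ∧ 1 ≤ Dinc₁ ∧ ∃ Cκ₀ CJ₀ Cα : ℝ, 0 < Cκ₀ ∧ 0 < CJ₀ ∧ 0 < Cα ∧
      ∃ Cκz Cbz CJz : ℝ, 0 < Cκz ∧ 0 < Cbz ∧ 0 < CJz ∧ ∃ CWi : ℝ, 0 < CWi ∧
      (R.WF2 → ∃ c₃' : ℝ, 0 < c₃' ∧ ∃ U₀' : ℝ, 0 < U₀' ∧
      ∀ P : SplitConsts, P.WF → ∃ c₀ : ℝ, 0 < c₀ ∧ ∃ U₁ : ℝ, 0 < U₁ ∧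
      ∀ (G : GeoConsts) (Q : EngConsts) (c : ℝ), 0 < c → c ≤ klEngC₃6 P R → c ≤ c₃' → c ≤ c₀ →
      ∀ μ ∈ klWindowC, ∀ U : ℝ, 0 < U → U ≤ klEngU₀9 P R c → U ≤ U₀' → U ≤ U₁ → c'' * U ≤ 1 →
      ∀ β : ℝ, klBetaMin ≤ β → β ≤ Real.exp (c / U ^ 2) →
      ∀ (L M : ℕ) [NeZero L] [NeZero M], klEngL₃ β U ≤ L → klEngM₃ β U L ≤ M →
      ∀ n : ℕ, 1 ≤ n → n ≤ nScales β + 1 → IsKLRegime U c (-(n : ℤ)) → HistP klPredsV17F2 L M G P Q R β U μ 0 n →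
        (∀ m', 1 ≤ m' → m' < n → FlowPieceOscAt L M c'' β U μ m') →
      2 ≤ d →
      -- the degree caps [choice: `exists_degreeCap`] (+ block `0`'s input family `F_0`)
      ∀ D : ℕ, 3 ≤ D → (∀ k, 1 ≤ k → d * k ≤ n → Fintype.card (SpaceTimeIdx L M × SectorLeg (sectorCount (d * k - 1))) / 2 ≤ D) →
        Fintype.card (HubbardFieldIdx L M) ≤ 2 * D + 1 → Fintype.card (SpaceTimeIdx L M × SectorLeg (sectorCount 0)) / 2 ≤ D →
      -- the coupling amplitude and the law's constants
      ∀ (B A Q' Ab Qb : ℝ), 1 ≤ B → 0 ≤ A → 0 < Q' → 0 ≤ Ab → 0 ≤ Qb →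
      -- BLOCK 0's BASE LAW (p3 WB3): the block-0 names, the level-0 weighted datum of `𝒱_1` at `(F_0, rate j)` [kit currency], block 0's numerics at `λ_j`
      ∀ (Ab₀ Qb₀ : ℝ), 0 ≤ Ab₀ → 0 ≤ Qb₀ →
      ∀ (αb₀ κb₀ crb₀ ccb₀ W₀ Z₀ σ₀ τ₀ ψ₀ Φ₀ : ℝ), αb₀ = Cα * ((M : ℝ) / β) → κb₀ = Real.sqrt (2 * Cκ₀ * klE0) → crb₀ = 81 * CJ₀ * M / β →
        ccb₀ = 162 * CJ₀ * M / β → W₀ = 32 * crb₀ / ccb₀ → Z₀ = imagTimeWeight β M ^ 2 * ccb₀ ^ 2 / 8 → σ₀ = κb₀ ^ 2 / ccb₀ ^ 2 →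
        τ₀ = 4 * exp 4 * κb₀ ^ 2 / ccb₀ ^ 2 → ψ₀ = ccb₀ ^ 2 / κb₀ ^ 2 → Φ₀ = exp 1 * αb₀ * ccb₀ / (κb₀ ^ 2 * crb₀) →
      ∀ (A'₀ Q'₀ ι₁₀ ι₂₀ ι₃₀ : ℝ), 0 ≤ A'₀ → 0 < Q'₀ →
      (∀ j, d ≤ j → j ≤ n → ∀ p : ℕ, 3 ≤ p →
        klTowerMeasWtAt L M β U μ (klFlowFrameU L M β U μ n) 1 1 j (2 * p) / klLevUnitF β M 0 p 0 ≤ Ab₀ * (B * epsCoupling P U d) ^ (p - 1) * Qb₀ ^ p) →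
      (∀ j, d ≤ j → j ≤ n →
        (∀ m, 4 ≤ m → m ≤ D → W₀ * Z₀ ^ m * (klTowerMeasWtAt L M β U μ (klFlowFrameU L M β U μ n) 1 1 j (2 * m) / klLevUnitF β M 0 m 0) ≤
          A'₀ * (B * epsCoupling P U d) ^ (m - 1) * Q'₀ ^ m) ∧
        W₀ * Z₀ ^ 3 * (klTowerMeasWtAt L M β U μ (klFlowFrameU L M β U μ n) 1 1 j (2 * 3) / klLevUnitF β M 0 3 0) ≤ ι₃₀ * (B * epsCoupling P U d) ^ 2 ∧
        W₀ * Z₀ ^ 1 * (klTowerMeasWtAt L M β U μ (klFlowFrameU L M β U μ n) 1 1 j (2 * 1) / klLevUnitF β M 0 1 0) ≤ ι₁₀ * (B * epsCoupling P U d) ∧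
        W₀ * Z₀ ^ 2 * (klTowerMeasWtAt L M β U μ (klFlowFrameU L M β U μ n) 1 1 j (2 * 2) / klLevUnitF β M 0 2 0) ≤ ι₂₀ * (B * epsCoupling P U d) ∧
        4 * σ₀ * (B * epsCoupling P U d) * Q'₀ < 1 ∧ 2 * (B * epsCoupling P U d) * τ₀ * Q'₀ ≤ 1 ∧ exp 1 * τ₀ * (B * epsCoupling P U d) * Q'₀ < 1 ∧
        Φ₀ * (τ₀ * (ι₁₀ * (B * epsCoupling P U d) + ι₂₀ / (2 * Q'₀) + ι₃₀ / (4 * Q'₀ ^ 2) + A'₀ * Q'₀ / 4)) < 1 ∧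
        Φ₀ * (exp 1 * τ₀ * (ι₁₀ * (B * epsCoupling P U d)) + (exp 1 * τ₀) ^ 2 * (ι₂₀ * (B * epsCoupling P U d)) +
          (exp 1 * τ₀) ^ 3 * (ι₃₀ * (B * epsCoupling P U d) ^ 2) +
          A'₀ * (exp 1 * τ₀ * Q'₀) * ((exp 1 * τ₀ * (B * epsCoupling P U d) * Q'₀) ^ 3 / (1 - exp 1 * τ₀ * (B * epsCoupling P U d) * Q'₀))) < 1 ∧
        Φ₀ * towerV D τ₀ (fun m => W₀ * Z₀ ^ m *
          (klTowerMeasWtAt L M β U μ (klFlowFrameU L M β U μ n) 1 1 j (2 * m) / klLevUnitF β M 0 m 0)) < 1) →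
      ∀ (Aro₁ Qro₁ Qtot₁ Atot₁ : ℝ), Aro₁ = Cinc₁ * Ab₀ → Qro₁ = Dinc₁ * Qb₀ →
        Qtot₁ = Dinc₁ * max 1 (max Qro₁ (max (4 * Q'₀) (2 * τ₀ * ψ₀ * Q'₀))) →
        (Atot₁ = Aro₁ + Cinc₁ * (A'₀ * (4 * σ₀ * (B * epsCoupling P U d) * Q'₀ / (1 - 4 * σ₀ * (B * epsCoupling P U d) * Q'₀)) +
          exp 1 * (τ₀ * (ι₁₀ * (B * epsCoupling P U d) + ι₂₀ / (2 * Q'₀) + ι₃₀ / (4 * Q'₀ ^ 2) + A'₀ * Q'₀ / 4)) *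
            (Φ₀ * (τ₀ * (ι₁₀ * (B * epsCoupling P U d) + ι₂₀ / (2 * Q'₀) + ι₃₀ / (4 * Q'₀ ^ 2) + A'₀ * Q'₀ / 4)) /
              (1 - Φ₀ * (τ₀ * (ι₁₀ * (B * epsCoupling P U d) + ι₂₀ / (2 * Q'₀) + ι₃₀ / (4 * Q'₀ ^ 2) + A'₀ * Q'₀ / 4)))) / (2 * τ₀ * Q'₀))) →
        (d ≤ n → Atot₁ ≤ Ab) → Qtot₁ = Qb →
      -- BLOCK 0's Z-THREAD (p3 `towerZ_blockZero_klEng`): its four names and the block-0 PLAIN kit guard [numerics, kit currency; read only when `d ≤ n`]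
      ∀ (κz αz crz ccz : ℝ), κz = Real.sqrt (2 * Cκz * klE0) → αz = Cbz * ((M : ℝ) / β) * (4 : ℝ) ^ d / klE0 →
        crz = 81 * CJz * M / β → ccz = 162 * CJz * M / β →
      (d ≤ n → 9 * αz * ccz / ((27 : ℝ) ^ 5 * exp 1 * κz ^ 2 * crz) *
        towerV D (exp 2 * κz ^ 2 / ccz ^ 2)
          (fun m => 64 * (27 : ℝ) ^ 4 * exp 2 * crz / ccz * (exp 4 * ccz ^ 2 * imagTimeWeight β M ^ 2 / 8) ^ m *
            klTowerMuLevF L M β U μ (klFlowFrameU L M β U μ n) 1 1 m) < 1) →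
      -- dominants of the LINK's and of the read-out's constants, and the names
      ∀ (κb αb crb ccb : ℝ), Real.sqrt (2 * Cκ * klE0) ≤ κb → Cb * ((M : ℝ) / β) * (4 : ℝ) ^ d / klE0 ≤ αb →
        81 * CJ * M / β ≤ crb → 162 * CJ * M / β ≤ ccb →
        Real.sqrt (2 * Cκr * klE0) ≤ κb → Cbr * ((M : ℝ) / β) * (4 : ℝ) ^ d / klE0 ≤ αb → 81 * CJr * M / β ≤ crb → 162 * CJr * M / β ≤ ccb →
      ∀ (W Z σ τ ψ Φ : ℝ),
        W = 32 * crb / ccb → Z = imagTimeWeight β M ^ 2 * ccb ^ 2 / 8 →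
        σ = κb ^ 2 / ccb ^ 2 → τ = 4 * exp 4 * κb ^ 2 / ccb ^ 2 → ψ = ccb ^ 2 / κb ^ 2 → Φ = exp 1 * αb * ccb / (κb ^ 2 * crb) →
      ∀ (A' Q'' : ℝ),
        W * ((C₁ / C₂) * (8 : ℝ) ^ (d - 1) * (Ab + A / (1 - ((2 : ℝ) ^ d)⁻¹))) ≤ A' →
        Z * (C₂ ^ 2 * ((2 : ℝ) ^ (d - 1))⁻¹ * max Q' Qb) ≤ Q'' → W * Ab ≤ A' → Z * Qb ≤ Q'' → 0 < Q'' →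
      -- the weighted IMPORTS [E1]: the two-leg PLAIN line in the λ-FREE c-class shape `S₂·4^{−(dk−1)}` («E-b1-2LEG-SHAPE», E-b1 (2)) and the four-leg PLAIN line `s₄·λ_j`
      -- (every block `d·k ≤ j`, every rate `d ≤ j ≤ n`); the six-leg side = ONE family, the SECTORISED six-leg cell of `𝒱_j[K_n]` AT THE INPUT FAMILY `F_{j−1}` under a
      -- FREE amplitude `S₆·ε_j²·2^{4j}`, `d ≤ j ≤ n` (faces of record (R425)(3) (C1′) + (R423)(C) (D1); BGM 2006 (2.77) `|P_{v₀}| = 6`; p715234 §1's `hcell` shape) —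
      -- it feeds the six-leg import of every block `k ≥ 2` (§1, by name) AND the level's own `m = 6` clause (§2, one refinement level); no plain six-leg line anywhere
      ∀ (S₂ s₄ S₆ : ℝ), 0 ≤ S₂ → 0 ≤ s₄ → 0 ≤ S₆ →
      (∀ j, d ≤ j → j ≤ n → ∀ k, 1 ≤ k → d * k ≤ j → ∀ (q : Fin 2) (τ' : Fin 2 → SectorLeg 1) (y' : SpaceTimeIdx L M),
        imagTimeWeight β M ^ 1 * ∑ x' ∈ univ.filter (fun x' : Fin 2 → SpaceTimeIdx L M => x' q = y'),
          klScaleWt L M β j ((univ.image x').image (fun x : SpaceTimeIdx L M => (((((2 * (x.1 : ℕ) : ℕ)) : ZMod (2 * (2 * M)))), x.2))) *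
            ‖sectorisedKernel L M β (trivialMultiplier L M) (klTowerInput L M β U μ (klFlowFrameU L M β U μ n) d k) 2 τ' x'‖ ≤
          S₂ * ((4 : ℝ) ^ (d * k - 1))⁻¹) →
      (∀ j, d ≤ j → j ≤ n → ∀ k, 1 ≤ k → d * k ≤ j → ∀ (q : Fin 4) (τ' : Fin 4 → SectorLeg 1) (y' : SpaceTimeIdx L M),
        imagTimeWeight β M ^ 3 * ∑ x' ∈ univ.filter (fun x' : Fin 4 → SpaceTimeIdx L M => x' q = y'),
          klScaleWt L M β j ((univ.image x').image (fun x : SpaceTimeIdx L M => (((((2 * (x.1 : ℕ) : ℕ)) : ZMod (2 * (2 * M)))), x.2))) *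
            ‖sectorisedKernel L M β (trivialMultiplier L M) (klTowerInput L M β U μ (klFlowFrameU L M β U μ n) d k) 4 τ' x'‖ ≤ s₄ * (B * epsCoupling P U j)) →
      (∀ j, d ≤ j → j ≤ n → ∀ (q : Fin 6) (w : SpaceTimeIdx L M × SectorLeg (sectorCount (j - 1))),
        klWtPinnedSumOf L M β μ (klFlowFrameU L M β U μ n) (j - 1) 6 (klEffectiveAction L M β U μ (klFlowFrameU L M β U μ n) klE0 j) q w ≤
          S₆ * epsCoupling P U j ^ 2 * (2 : ℝ) ^ (4 * j)) →
      -- the import amplitudes they induce (two- and four-leg: equational, k3c2-p3's `importBindersWt_of_wplainLines_flow_all` fed with `s₂ := S₂/λ_j`, `i₁ ι₁` RATE-INDEXED;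
      -- six-leg: `ι₃` a NAME under two dominations [numerics] — block 1 from the base law (file C), blocks `k ≥ 2` from the input-family cell, `512·W·Z³·S₆·(M/β)⁵`)
      ∀ (i₁ ι₁ : ℕ → ℝ) (i₂ ι₂ ι₃ : ℝ), (∀ j, i₁ j = 2 * W * Z * klThinCount2C * CWi ^ 2 * (S₂ / (B * epsCoupling P U j))) →
        i₂ = 16 * W * Z ^ 2 * klThinCountC * CWi ^ 4 * s₄ →
        (∀ j, ι₁ j = i₁ j * ((M : ℝ) / β)) → ι₂ = i₂ * ((M : ℝ) / β) ^ 3 → W * Z ^ 3 * (Ab * Qb ^ 3) ≤ ι₃ →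
        512 * W * Z ^ 3 * S₆ * ((M : ℝ) / β) ^ 5 ≤ ι₃ →
      -- the kit's numerics at every read-out rate [p4 «part 4»]
      (∀ j, d ≤ j → j ≤ n →
        4 * σ * (B * epsCoupling P U j) * Q'' < 1 ∧ 2 * (B * epsCoupling P U j) * τ * Q'' ≤ 1 ∧ exp 1 * τ * (B * epsCoupling P U j) * Q'' < 1 ∧
        Φ * (τ * (ι₁ j * (B * epsCoupling P U j) + ι₂ / (2 * Q'') + ι₃ / (4 * Q'' ^ 2) + A' * Q'' / 4)) < 1 ∧
        Φ * (exp 1 * τ * (ι₁ j * (B * epsCoupling P U j)) + (exp 1 * τ) ^ 2 * (ι₂ * (B * epsCoupling P U j)) +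
          (exp 1 * τ) ^ 3 * (ι₃ * (B * epsCoupling P U j) ^ 2) +
          A' * (exp 1 * τ * Q'') * ((exp 1 * τ * (B * epsCoupling P U j) * Q'') ^ 3 / (1 - exp 1 * τ * (B * epsCoupling P U j) * Q''))) < 1 ∧
        4 * Q'' ≤ Q' ∧ 2 * τ * ψ * Q'' ≤ Q' ∧
        A' * (4 * Q'') ^ 3 * (4 * σ * (B * epsCoupling P U j) * Q'' / (1 - 4 * σ * (B * epsCoupling P U j) * Q'')) +
          exp 1 * ψ * (2 * τ * ψ * Q'') ^ 2 * (τ * (ι₁ j * (B * epsCoupling P U j) + ι₂ / (2 * Q'') + ι₃ / (4 * Q'' ^ 2) + A' * Q'' / 4)) *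
            (Φ * (τ * (ι₁ j * (B * epsCoupling P U j) + ι₂ / (2 * Q'') + ι₃ / (4 * Q'' ^ 2) + A' * Q'' / 4)) /
              (1 - Φ * (τ * (ι₁ j * (B * epsCoupling P U j) + ι₂ / (2 * Q'') + ι₃ / (4 * Q'' ^ 2) + A' * Q'' / 4)))) ≤ A * Q' ^ 3) →
      -- the read-out constants level by level and the budget package's `CE` row [p4]
      ∀ (Qe : EngConsts) (Atot Qtot : ℕ → ℝ),
        (∀ j, Qtot j = max 1 (C₂i ^ 2) * max 1 (max (C₂r ^ 2 * max Q' Qb) (max (4 * Q'') (2 * τ * ψ * Q'')))) →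
        (∀ j, Atot j = C₁r / C₂r * (Ab + A) + C₁i / C₂i * (A' * (4 * σ * (B * epsCoupling P U j) * Q'' / (1 - 4 * σ * (B * epsCoupling P U j) * Q'')) +
          exp 1 * (τ * (ι₁ j * (B * epsCoupling P U j) + ι₂ / (2 * Q'') + ι₃ / (4 * Q'' ^ 2) + A' * Q'' / 4)) *
            (Φ * (τ * (ι₁ j * (B * epsCoupling P U j) + ι₂ / (2 * Q'') + ι₃ / (4 * Q'' ^ 2) + A' * Q'' / 4)) /
              (1 - Φ * (τ * (ι₁ j * (B * epsCoupling P U j) + ι₂ / (2 * Q'') + ι₃ / (4 * Q'' ^ 2) + A' * Q'' / 4)))) / (2 * τ * Q''))) →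
        (∀ j, d ≤ j → j ≤ n → Qtot j * imagTimeWeight β M ^ 2 * B * max 1 (Atot j / imagTimeWeight β M) ≤ Qe.CE) → (klEngQ7 P R).IsRaiseOf Qe →
      -- the six-leg threshold lifting the own-family `m = 6` clause (§2, amplitude `C₆c·16·S₆`) to the budget `klWtBudget P Qe U j 6` [numerics, lower bound on `Qe.CE`]
      C₆c * 16 * S₆ ≤ Qe.CE ^ 3 →
      -- the four-leg import CELL at `d ≤ j ≤ n`: the weighted PLAIN four-leg pinned line of `𝒱_j[K_n]` at `(F_j, rate j)` [E1] and its threshold [numerics]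
      -- (the six-leg cell sits with the structural inputs above; the own-family `m = 6` clause is DERIVED from it here)
      ∀ (S₄ : ℕ → ℝ), (∀ j, 0 ≤ S₄ j) →
      (∀ j, d ≤ j → j ≤ n → ∀ (q : Fin 4) (τ' : Fin 4 → SectorLeg 1) (y' : SpaceTimeIdx L M),
        imagTimeWeight β M ^ 3 * ∑ x' ∈ univ.filter (fun x' : Fin 4 → SpaceTimeIdx L M => x' q = y'),
          klScaleWt L M β j ((univ.image x').image (fun x : SpaceTimeIdx L M => (((((2 * (x.1 : ℕ) : ℕ)) : ZMod (2 * (2 * M)))), x.2))) *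
            ‖sectorisedKernel L M β (trivialMultiplier L M) (klEffectiveAction L M β U μ (klFlowFrameU L M β U μ n) klE0 j) 4 τ' x'‖ ≤ S₄ j) →
      (∀ j, d ≤ j → j ≤ n → klThinCountC * sectorCount j * (CW₄ ^ 4 * S₄ j) ≤ klWtBudget P Qe U j 4) →
      -- THE BLOCK-0 LEVELS `1 ≤ j < d`, weighted [p3 «WB4»]
      (∀ j, 1 ≤ j → j < d → j ≤ n → KernelNormsWt4 L M (klWtBudget P Qe U j) β U μ (klFlowFrameU L M β U μ n) j) →
      ∀ j, j ≤ n → KernelNormsWt4 L M (klWtBudget P Qe U j) β U μ (klFlowFrameU L M β U μ n) j) := by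
  obtain ⟨C₁, C₂, Cκ, CJ, C₁r, C₂r, Cκr, CJr, C₁i, C₂i, hC₁, hC₂, hCκ, hCJ, hC₁r, hC₂r, hCκr, hCJr, hC₁i, hC₂i, hrowsU⟩ :=
    kernelNormsWt4_all_klEng_rows_sharp4 R c'' hc''
  obtain ⟨CW₄, hCW₄, hc4⟩ := klWtPinnedSum_four_le_of_wplain_flow_all R c'' hc''.le
  obtain ⟨C₆c, hC₆c, hc6rU⟩ := klWtPinnedSum_six_le_of_inputFamilyCell_klEng_flow_all R c'' hc''.le
  refine ⟨C₁, C₂, Cκ, CJ, C₁r, C₂r, Cκr, CJr, C₁i, C₂i, hC₁, hC₂, hCκ, hCJ, hC₁r, hC₂r, hCκr, hCJr, hC₁i, hC₂i, CW₄, C₆c, hCW₄, hC₆c, fun d => ?_⟩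
  obtain ⟨Cb, Cbr, hCb, hCbr, Cinc₁, Dinc₁, hCinc₁, hDinc₁, Cκ₀, CJ₀, Cα, hCκ₀, hCJ₀, hCα, hall⟩ := hrowsU d
  obtain ⟨Cκz, Cbz, CJz, hCκz, hCbz, hCJz, hZt⟩ := towerZ_blockZero_klEng d R c'' hc''
  obtain ⟨CWi, hCWi, himpW⟩ := importBindersWt_of_wplainLines_flow_all d R c'' hc''.le
  refine ⟨Cb, Cbr, hCb, hCbr, Cinc₁, Dinc₁, hCinc₁, hDinc₁, Cκ₀, CJ₀, Cα, hCκ₀, hCJ₀, hCα, Cκz, Cbz, CJz, hCκz, hCbz, hCJz, CWi, hCWi,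
    fun hR2 => ?_⟩
  obtain ⟨c₃a, hc₃a, U₀a, hU₀a, hall'⟩ := hall hR2
  obtain ⟨c₃s, hc₃s, U₀s, hU₀s, hc6r⟩ := hc6rU hR2
  refine ⟨min (min c₃a (min (klThinCountC₃ R) (min (klThinCount6C₃ R) (klThinCount2C₃ R)))) c₃s,
    lt_min (lt_min hc₃a (lt_min (klThinCountC₃_pos R) (lt_min (klThinCount6C₃_pos R) (klThinCount2C₃_pos R)))) hc₃s,
    min (min U₀a (min (klThinCountU₀ R) (min (klThinCount6U₀ R) (klThinCount2U₀ R)))) U₀s,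
    lt_min (lt_min hU₀a (lt_min (klThinCountU₀_pos R) (lt_min (klThinCount6U₀_pos R) (klThinCount2U₀_pos R)))) hU₀s, fun P hP => ?_⟩
  obtain ⟨c₀, hc₀, U₁, hU₁, hZ1'⟩ := exists_partitionFn_scaleOne_ne_zero_unif P R hR2
  refine ⟨c₀, hc₀, U₁, hU₁, ?_⟩
  intro G Q c hc hc6 hc₃' hcc₀ μ hμ U hU hU9 hU₀' hUU₁ hcU β hβmin hβc L M _ _ hL3 hM3 n hn1 hnN hkl hhist hosc hd D hD3 hD hcard hD0
    B A Q' Ab Qb hB hA hQ hAb hQb Ab₀ Qb₀ hAb₀ hQb₀ αb₀ κb₀ crb₀ ccb₀ W₀ Z₀ σ₀ τ₀ ψ₀ Φ₀ hαb₀ hκb₀ hcrb₀ hccb₀ hW₀ hZ₀ hσ₀ hτ₀ hψ₀ hΦ₀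
    A'₀ Q'₀ ι₁₀ ι₂₀ ι₃₀ hA'₀ hQ'₀ hlawb₀ hblk0 Aro₁ Qro₁ Qtot₁ Atot₁ hAro₁ hQro₁ hQtot₁ hAtot₁ hAtotle hQtotQb
    κz αz crz ccz hκz hαz hcrz hccz hguardz
    κb αb crb ccb hκb hαb hcrb hccb hκbr hαbr hcrbr hccbr W Z σ τ ψ Φ hW hZ' hσ hτ hψ hΦ
    A' Q'' hA'1 hQ'1 hA'2 hQ'2 hQ'0 S₂ s₄ S₆ hS₂0 hs₄ hS₆ hS₂ hS₄ hC6in i₁ ι₁ i₂ ι₂ ι₃ hi₁ hi₂ hι₁ hι₂ hdomAQ hdomS hnum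
    Qe Atot Qtot hQtot hAtot hCE hQe hT6 S₄ hS₄0 hL4 hT4 hlow' j hjn
  -- the folded doors
  have hc₃s' : c ≤ c₃s := hc₃'.trans (min_le_right _ _)
  have hU₀s' : U ≤ U₀s := hU₀'.trans (min_le_right _ _)
  replace hc₃' := hc₃'.trans (min_le_left _ _)
  replace hU₀' := hU₀'.trans (min_le_left _ _)
  have hc₃a' : c ≤ c₃a := hc₃'.trans (min_le_left _ _)
  have hcT : c ≤ klThinCountC₃ R := hc₃'.trans ((min_le_right _ _).trans (min_le_left _ _))
  have hcT6 : c ≤ klThinCount6C₃ R := hc₃'.trans ((min_le_right _ _).trans ((min_le_right _ _).trans (min_le_left _ _)))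
  have hcT2 : c ≤ klThinCount2C₃ R := hc₃'.trans ((min_le_right _ _).trans ((min_le_right _ _).trans (min_le_right _ _)))
  have hU₀a' : U ≤ U₀a := hU₀'.trans (min_le_left _ _)
  have hUT : U ≤ klThinCountU₀ R := hU₀'.trans ((min_le_right _ _).trans (min_le_left _ _))
  have hUT6 : U ≤ klThinCount6U₀ R := hU₀'.trans ((min_le_right _ _).trans ((min_le_right _ _).trans (min_le_left _ _)))
  have hUT2 : U ≤ klThinCount2U₀ R := hU₀'.trans ((min_le_right _ _).trans ((min_le_right _ _).trans (min_le_right _ _)))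
  have hU3g : U ≤ min (klEngU₀3 P R c) (1 / (R.Gfr 3 + 1)) :=
    le_min (hU9.trans (klEngU₀9_le_klEngU₀3 P R c)) (hU9.trans (klEngU₀9_le_inv_gfr_add_one P hR2.wf c (by norm_num)))
  have hβ : 0 < β := KLRegimeSplit.pos_of_klBetaMin_le hβmin
  have hK1 : 1 ≤ P.Klam := hP.1
  have hKl : 0 ≤ P.Klam := le_trans zero_le_one hK1
  have hB0 : 0 ≤ B := zero_le_one.trans hB
  have hM0 : (0 : ℝ) < M := Nat.cast_pos.2 (Nat.pos_of_ne_zero (NeZero.ne M))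
  have hfr : FrameOK R U (nScales β) μ (klFlowFrameU L M β U μ n) := frameOK_klFlowFrameU_of_histP_le hR2 hn1 le_rfl hnN hhist
  set K : TrigPolyC4v := klFlowFrameU L M β U μ n with hKdef
  -- `Z^{K_n}_{Λ_1} ≠ 0` (p3, c-uniform doors)
  have hZ1 : hubbardEffPartitionFnCT L M β U μ 0 K (klScale klE0 1) ≠ 0 :=
    hZ1' c hc hcc₀ μ hμ U hU hU9 hUU₁ β hβmin hβc L M hL3 hM3 K hfr
  -- the level `j = 0` (k3c2-p1's scale-zero theorem at `klEngQ7`, lifted along the raise) and the low levels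
  have hCE0 : 0 ≤ Qe.CE := (klEngQ7_wf P R).1.trans hQe.CE_le
  have hlow : ∀ j, j < d → j ≤ n → KernelNormsWt4 L M (klWtBudget P Qe U j) β U μ K j := by
    intro j hjd hjn
    rcases Nat.eq_zero_or_pos j with rfl | hj1
    · exact kernelNormsWt4_klWtBudget_of_isRaiseOf hQe (klEngQ7_wf P R).1 hKl
        (kernelNormsWt4_zero_klWtBudget_klEngQ7U9 P R c hP hR2 hc hc6 μ hμ U hU hU9 β hβmin hβc K hfr L M hL3 hM3)
    · exact hlow' j hj1 hjd hjn
  rcases Nat.lt_or_ge n d with hnd | hdn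
  · exact hlow j (by omega) hjn
  -- `d ≤ n`: `Z^{K_n}_{Λ_d} ≠ 0` from block 0's Z-thread at `j := d`
  have hZd : hubbardEffPartitionFnCT L M β U μ 0 K (klScale klE0 d) ≠ 0 :=
    hZt G P Q c hP hR2 hc hc6 μ hμ U hU hU9 hcU β hβmin hβc L M hL3 hM3 n hn1 hnN hkl hhist hfr hosc d (by omega) le_rfl hdn hZ1 D hD0
      κz αz crz ccz hκz hαz hcrz hccz (hguardz hdn)
  -- signs of the kit names
  have hcrb0 : 0 < crb := lt_of_lt_of_le (by positivity) hcrb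
  have hccb0 : 0 < ccb := lt_of_lt_of_le (by positivity) hccb
  have hW0 : 0 ≤ W := by rw [hW]; positivity
  have hZ0 : 0 ≤ Z := by rw [hZ']; positivity
  have hε0 : ∀ i, 0 ≤ epsCoupling P U i := fun i => epsCoupling_nonneg' hKl U i
  -- the two- and four-leg weighted import binders from the weighted plain lines (k3c2-p3), rate by rate with `K_b := j / d`; the six-leg slot of the
  -- three-line glue is fed the trivial finite bound of its (finitely many) plain sums and its output DISCARDED (♯4 (ii): the six-leg import is sectorised)
  have himp : ∀ j, d ≤ j → j ≤ n →
      (∀ k, 1 ≤ k → d * k ≤ j → W * Z ^ 1 *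
        (klTowerMeasWtAt L M β U μ K d k j (2 * 1) / klLevUnitF β M 0 1 (d * k - 1)) ≤ ι₁ j * (B * epsCoupling P U j)) ∧
      (∀ k, 1 ≤ k → d * k ≤ j → W * Z ^ 2 *
        (klTowerMeasWtAt L M β U μ K d k j (2 * 2) / klLevUnitF β M 0 2 (d * k - 1)) ≤ ι₂ * (B * epsCoupling P U j)) := by
    intro j hjd hjn
    have hdpos : 0 < d := by omega
    have hKb1 : 1 ≤ j / d := (Nat.le_div_iff_mul_le hdpos).2 (by simpa using hjd)
    have hKbj : d * (j / d) ≤ j := by rw [mul_comm]; exact Nat.div_mul_le_self j d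
    have hkK : ∀ k, d * k ≤ j → k ≤ j / d := fun k hk => (Nat.le_div_iff_mul_le hdpos).2 (by rw [mul_comm]; exact hk)
    have hεj : 0 < epsCoupling P U j := by
      unfold epsCoupling; have : 0 < P.Klam := by linarith
      positivity
    have hlamj : 0 < B * epsCoupling P U j := mul_pos (lt_of_lt_of_le one_pos hB) hεj
    have hs₂j : 0 ≤ S₂ / (B * epsCoupling P U j) := div_nonneg hS₂0 hlamj.le
    have hS₂' : ∀ k, 1 ≤ k → k ≤ j / d → ∀ (q : Fin 2) (τ' : Fin 2 → SectorLeg 1) (y' : SpaceTimeIdx L M),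
        imagTimeWeight β M ^ 1 * ∑ x' ∈ univ.filter (fun x' : Fin 2 → SpaceTimeIdx L M => x' q = y'),
          klScaleWt L M β j ((univ.image x').image (fun x : SpaceTimeIdx L M => (((((2 * (x.1 : ℕ) : ℕ)) : ZMod (2 * (2 * M)))), x.2))) *
            ‖sectorisedKernel L M β (trivialMultiplier L M) (klTowerInput L M β U μ K d k) 2 τ' x'‖ ≤
          S₂ / (B * epsCoupling P U j) * ((4 : ℝ) ^ (d * k - 1))⁻¹ * (B * epsCoupling P U j) := by
      intro k hk hkK q τ' y'
      have h := hS₂ j hjd hjn k hk (le_trans (Nat.mul_le_mul_left d hkK) hKbj) q τ' y'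
      rwa [div_mul_eq_mul_div, div_mul_cancel₀ _ hlamj.ne']
    obtain ⟨s₆, hs₆, hS₆'⟩ : ∃ s₆ : ℝ, 0 ≤ s₆ ∧ ∀ k, 1 ≤ k → k ≤ j / d → ∀ (q : Fin 6) (τ' : Fin 6 → SectorLeg 1) (y' : SpaceTimeIdx L M),
        imagTimeWeight β M ^ 5 * ∑ x' ∈ univ.filter (fun x' : Fin 6 → SpaceTimeIdx L M => x' q = y'),
          klScaleWt L M β j ((univ.image x').image (fun x : SpaceTimeIdx L M => (((((2 * (x.1 : ℕ) : ℕ)) : ZMod (2 * (2 * M)))), x.2))) *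
            ‖sectorisedKernel L M β (trivialMultiplier L M) (klTowerInput L M β U μ K d k) 6 τ' x'‖ ≤ s₆ * (B * epsCoupling P U j) ^ 2 := by
      obtain ⟨C, hC⟩ := Finite.exists_le (fun a : Fin (j / d + 1) × Fin 6 × (Fin 6 → SectorLeg 1) × SpaceTimeIdx L M =>
        imagTimeWeight β M ^ 5 * ∑ x' ∈ univ.filter (fun x' : Fin 6 → SpaceTimeIdx L M => x' a.2.1 = a.2.2.2),
          klScaleWt L M β j ((univ.image x').image (fun x : SpaceTimeIdx L M => (((((2 * (x.1 : ℕ) : ℕ)) : ZMod (2 * (2 * M)))), x.2))) *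
            ‖sectorisedKernel L M β (trivialMultiplier L M) (klTowerInput L M β U μ K d (a.1 : ℕ)) 6 a.2.2.1 x'‖)
      refine ⟨max C 0 / (B * epsCoupling P U j) ^ 2, by positivity, fun k hk hkK q τ' y' => ?_⟩
      rw [div_mul_cancel₀ _ (pow_pos hlamj 2).ne']
      exact (hC (⟨k, by omega⟩, q, τ', y')).trans (le_max_left _ _)
    obtain ⟨h1, h2, -⟩ := himpW G P Q c hR2 hc hc6 hcT hcT6 hcT2 μ hμ U hU hU3g hUT hUT6 hUT2 hcU β hβmin hβc L M hL3 hM3 n hn1 hnN hkl hhist hosc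
      hd (j / d) j hKb1 hKbj hjn W Z (B * epsCoupling P U j) (S₂ / (B * epsCoupling P U j)) s₄ s₆ hW0 hZ0 (mul_nonneg hB0 (hε0 j)) hs₂j hs₄ hs₆ hS₂'
      (fun k hk hkK => hS₄ j hjd hjn k hk (le_trans (Nat.mul_le_mul_left d hkK) hKbj)) hS₆' (i₁ j) i₂
      (131072 * W * Z ^ 3 * klThinCount6C * CWi ^ 6 * s₆) (hi₁ j) hi₂ rfl
    refine ⟨fun k hk hkj => ?_, fun k hk hkj => ?_⟩
    · rw [hι₁ j]; exact h1 k hk (hkK k hkj)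
    · rw [hι₂]; exact h2 k hk (hkK k hkj)
  -- (C1′) §1: the six-leg import rows at blocks `k ≥ 2` READ BY NAME off the input-family cell at `j = dk` (k3c2-p3's `importRowSix_of_inputFamilyCell`),
  -- then `ε_{dk} ≤ ε_j ≤ B·ε_j` and the domination `512·W·Z³·S₆·(M/β)⁵ ≤ ι₃`
  have hεmono : ∀ {a b : ℕ}, a ≤ b → epsCoupling P U a ≤ epsCoupling P U b := fun {a b} hab => by
    unfold epsCoupling
    exact mul_le_mul_of_nonneg_left ((add_le_add_iff_left |U|).2 (mul_le_mul_of_nonneg_left (Nat.cast_le.2 hab) (sq_nonneg U))) hKl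
  have hι₃' : ∀ j, d ≤ j → j ≤ n → ∀ k, 2 ≤ k → d * k ≤ j → W * Z ^ 3 *
      (klTowerMeasWtAt L M β U μ K d k j (2 * 3) / klLevUnitF β M 0 3 (d * k - 1)) ≤ ι₃ * (B * epsCoupling P U j) ^ 2 := by
    intro j hjd hjn k hk2 hkj
    have hdk : d ≤ d * k := Nat.le_mul_of_pos_right d (by omega)
    have hrow := importRowSix_of_inputFamilyCell (L := L) (M := M) hβ U μ K P d k (by omega) (by omega : d * k - 1 ≤ j) hW0 hZ0 hS₆
      (hC6in (d * k) hdk (hkj.trans hjn))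
    have hεB : epsCoupling P U (d * k) ^ 2 ≤ (B * epsCoupling P U j) ^ 2 :=
      pow_le_pow_left₀ (hε0 _) ((hεmono hkj).trans (le_mul_of_one_le_left (hε0 j) hB)) 2
    show W * Z ^ 3 * (klTowerMeasWtAt L M β U μ K d k j 6 / klLevUnitF β M 0 3 (d * k - 1)) ≤ ι₃ * (B * epsCoupling P U j) ^ 2
    calc W * Z ^ 3 * (klTowerMeasWtAt L M β U μ K d k j 6 / klLevUnitF β M 0 3 (d * k - 1))
        ≤ 512 * W * Z ^ 3 * S₆ * ((M : ℝ) / β) ^ 5 * epsCoupling P U (d * k) ^ 2 := hrow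
      _ ≤ 512 * W * Z ^ 3 * S₆ * ((M : ℝ) / β) ^ 5 * (B * epsCoupling P U j) ^ 2 := mul_le_mul_of_nonneg_left hεB (by positivity)
      _ ≤ ι₃ * (B * epsCoupling P U j) ^ 2 := mul_le_mul_of_nonneg_right hdomS (pow_nonneg (mul_nonneg hB0 (hε0 j)) 2)
  -- the two import cells: weighted plain lines (k3c2-p3) + thresholds at `d ≤ j`, the low levels below `d`
  have hcell4 : ∀ j, j ≤ n → ∀ (q : Fin 4) (w : SpaceTimeIdx L M × SectorLeg (sectorCount j)),
      klWtPinnedSum L M β U μ K j 4 q w ≤ klWtBudget P Qe U j 4 := by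
    intro j hjn q w
    rcases Nat.lt_or_ge j d with hjd | hjd
    · exact hlow j hjd hjn 4 (by norm_num) q w
    · exact (hc4 G P Q c hR2 hc hc6 hcT μ hμ U hU hU3g hUT hcU β hβmin hβc L M hL3 hM3 n hn1 hnN hkl hhist hosc j (by omega) hjn q w (S₄ j) (hS₄0 j)
        (fun τ' y' => hL4 j hjd hjn q τ' y')).trans (hT4 j hjd hjn)
  -- (C1′) §2: the own-family six-leg cell at `d ≤ j` from the input-family cell by ONE refinement level (k3c2-p3's
  -- `klWtPinnedSum_six_le_of_inputFamilyCell_klEng_flow_all`, amplitude `C₆c·16·S₆`), lifted to the budget by `C₆c·16·S₆ ≤ Qe.CE³`; below `d` off the low levels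
  have hcell6 : ∀ j, j ≤ n → ∀ (q : Fin 6) (w : SpaceTimeIdx L M × SectorLeg (sectorCount j)),
      klWtPinnedSum L M β U μ K j 6 q w ≤ klWtBudget P Qe U j 6 := by
    intro j hjn q w
    rcases Nat.lt_or_ge j d with hjd | hjd
    · exact hlow j hjd hjn 6 (by norm_num) q w
    · have hB6 : 0 ≤ S₆ * epsCoupling P U j ^ 2 * (2 : ℝ) ^ (4 * j) := by positivity
      refine (hc6r G P Q c hc hc6 hc₃s' μ hμ U hU hU3g hU₀s' hcU β hβmin hβc L M hL3 hM3 n hn1 hnN hkl hhist hosc j (by omega) hjn _ hB6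
        (hC6in j hjd hjn) q w).trans ?_
      rw [klWtBudget_six_eq]
      calc C₆c * 16 * (S₆ * epsCoupling P U j ^ 2 * (2 : ℝ) ^ (4 * j)) = (C₆c * 16 * S₆) * (epsCoupling P U j ^ 2 * (2 : ℝ) ^ (4 * j)) := by ring
        _ ≤ Qe.CE ^ 3 * (epsCoupling P U j ^ 2 * (2 : ℝ) ^ (4 * j)) := mul_le_mul_of_nonneg_right hT6 (by positivity)
        _ = Qe.CE ^ 3 * epsCoupling P U j ^ 2 * (2 : ℝ) ^ (4 * j) := by ring
  exact hall' G P Q c hP hc hc6 hc₃a' μ hμ U hU hU9 hU₀a' hcU β hβmin hβc L M hL3 hM3 n hn1 hnN hkl hhist hosc hd hdn D hD3 hD hcard hD0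
    B A Q' Ab Qb hB hA hQ hAb hQb hZ1 hZd Ab₀ Qb₀ hAb₀ hQb₀ αb₀ κb₀ crb₀ ccb₀ W₀ Z₀ σ₀ τ₀ ψ₀ Φ₀ hαb₀ hκb₀ hcrb₀ hccb₀ hW₀ hZ₀ hσ₀ hτ₀ hψ₀ hΦ₀
    A'₀ Q'₀ ι₁₀ ι₂₀ ι₃₀ hA'₀ hQ'₀ hlawb₀ hblk0 Aro₁ Qro₁ Qtot₁ Atot₁ hAro₁ hQro₁ hQtot₁ hAtot₁ hAtotle hQtotQb
    κb αb crb ccb hκb hαb hcrb hccb hκbr hαbr hcrbr hccbr W Z σ τ ψ Φ hW hZ' hσ hτ hψ hΦ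
    A' Q'' hA'1 hQ'1 hA'2 hQ'2 hQ'0 ι₁ ι₂ ι₃ (fun j hjd hjn => (himp j hjd hjn).1) (fun j hjd hjn => (himp j hjd hjn).2) hdomAQ
    hι₃' hnum Qe Atot Qtot hQtot hAtot hCE hCE0 hcell4 hcell6 hlow j hjn

end Summit.HubbardSuperconductivity.HubbardSuperconductivity.Theorems.EngineV8

end
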